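import Summits.Ventures.Crystal3D.Theorems.StickyWulffConstantCoaxialWallLawSharpTrans
import Summits.Ventures.Crystal3D.Theorems.StickyWulffConstantCoaxialWallLawSharpTransGeneric
import Summits.Ventures.Crystal3D.Theorems.StickyWulffConstantCoaxialWallLawSharpTwin
import Summits.Ventures.Crystal3D.Theorems.StickyWulffConstantCoaxialWallLawExactUnion
import Summits.Ventures.Crystal3D.Theorems.StickyWulffConstantCoaxialWallLawWallLedgerFDefs
import HarnessLib

/-!
# THE STUB `CoaxialTwoSlabAdhesion` OF LINE `WallLedgerF` AT ITS OWN CONSTANT `½`, for EVERY co-axial pair —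
# conditional on the named census facts (E1 rows, k-fold tops) and the kissing gap

HONEST FRAMING. Part of the venture `Summits/Ventures/Crystal3D` (cell `crystal3d-full`), helper
`--supports` the crux `CoaxialWallLaw` (stmt-Ventures-19481, `route-Ventures-StickyWulffConstant`),
REGISTERED line `WallLedgerF` (planner cf-p1 gen 16), open stub `stub_coaxialTwoSlabAdhesion : CoaxialTwoSlabAdhesion`
(`…WallLedgerFDefs`).  CONDITIONAL RESULT — the stub is NOT closed: its inequality, with ITS OWN constant
`½·√(1 − ⟪L e₃, e₃⟫²)`, is derived for every co-axial pair of distinct moved fcc lattices, arbitrary fillings, no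
residual, h-uniform, from INPUTS BY NAME that are certified-computation targets of the cell, NOT theorems of the tree:
the E1 census rows C12-55 (`hcert`, `ExactOnly 0 (star s₀)`; cf-p2 R39c/P5) and the A12 glide star (`hcertA`, SLOTEX
A12-583; cf-p2 R38 j298241), the k-fold-top census `KFoldTopDeficit` (`…KFoldTop`, POSITED; k = 2 fcc/fcc =
`DoubleTopFar` certified ×2, hcp-predecessor and k ≥ 3 rows OPEN), and the kissing gap `KissingGap δ` (`δ > 0`,
`δ² > 16/3`; `δ = 5/2` is the cell's GAP(5/4) census).

* `coaxialTwoSlabAdhesion_translate_of_census` — translation pairs (`A₁·Λ₀ = A₂·Λ₀`): by the skew trichotomy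
  (`…SkewArithmetic`, `…SkewRoots`, `…SkewAxis`) and the sharp translation rungs (`…SharpTrans`, each reachable line
  end consuming its own missing contact, 19481-p1 g6's `…EndKFold`): (A) generic ⇒ `½` orientation-free,
  (B) doubly skew axis ⇒ the defender RE-PICKS the axis, `½·sin θ'` EXACTLY (`exists_skewRoot_of_axis_sine`),
  (C) skew plane ⇒ `(√6/4)·sin θ' ≥ ½·sin θ'`.
* **`coaxialTwoSlabAdhesion_of_census : … → CoaxialTwoSlabAdhesion`** — THE REGISTERED STUB'S PROPOSITION BY NAME:
  twins by 19481-p1's `coaxialTwoSlabAdhesion_general_twin_of_census` (`…SharpTwin`), translations by the above.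
The crux form (`CoaxialWallLaw` by name, modulo the same inputs) is `…CoaxialWallLawOfCensus`.

WHAT THIS IS NOT: a proof of the stub (the census rows are hypotheses); F-C1 not moved.
-/

noncomputable section

namespace Summit.Ventures.Crystal3D.Theorems

open Summit.Ventures.Crystal3D Finset NearIdentity
open Literature.MathematicalPhysics.StatisticalMechanics (fccStacking barlowStacking IsHaggSeq constHagg
  isHaggSeq_const contactDeficiency)
open scoped InnerProductSpace

section Exact

variable {δ : ℝ} (hg : KissingGap δ) (hδ0 : 0 < δ) (hδ : 16 / 3 < δ ^ 2) (hK : KFoldTopDeficit)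
  {s₀ : EuclideanSpace ℝ (Fin 3)} (hs₀ : s₀ ∈ fccSlots)
  (hcert : ExactOnly 0 (fccSlots.filter fun w => 0 < ⟪w, s₀⟫_ℝ))
  (hcertA : ∀ (A : EuclideanSpace ℝ (Fin 3) ≃ₗᵢ[ℝ] EuclideanSpace ℝ (Fin 3)) (n : EuclideanSpace ℝ (Fin 3)),
    ‖n‖ = 1 → (∀ w ∈ fccSlots, ⟪A w, n⟫_ℝ = 0 ∨ ⟪A w, n⟫_ℝ = Real.sqrt (2 / 3) ∨ ⟪A w, n⟫_ℝ = -Real.sqrt (2 / 3)) →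
    ∀ u ∈ fccSlots, ⟪A u, n⟫_ℝ = 0 → ∀ b : EuclideanSpace ℝ (Fin 3),
    ExactOnly b (insert (b - A u)
      (((fccSlots.filter fun s => ⟪s, u⟫_ℝ = -(1 / 2) ∧ ⟪A (u + s), n⟫_ℝ ≤ 0).image (fun s => b + A s)) ∪
        ((fccSlots.filter fun s => ⟪s, u⟫_ℝ = -(1 / 2) ∧ ⟪A (u + s), n⟫_ℝ < 0).image
          (fun s => b + (A s - (2 * ⟪A s, n⟫_ℝ) • n))))))
include hg hδ0 hδ hK hs₀ hcert hcertA

open scoped Classical in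
/-- **TRANSLATION pairs at the stub's constant** (`A₁·Λ₀ = A₂·Λ₀`, `Λ₁ ≠ Λ₂`): for SOME frame, charge `½·sin θ`,
modulo the named census facts.  See the module docstring. -/
theorem coaxialTwoSlabAdhesion_translate_of_census
    (A₁ : EuclideanSpace ℝ (Fin 3) ≃ₗᵢ[ℝ] EuclideanSpace ℝ (Fin 3)) (t₁ : EuclideanSpace ℝ (Fin 3))
    (A₂ : EuclideanSpace ℝ (Fin 3) ≃ₗᵢ[ℝ] EuclideanSpace ℝ (Fin 3)) (t₂ : EuclideanSpace ℝ (Fin 3))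
    (L : EuclideanSpace ℝ (Fin 3) ≃ₗᵢ[ℝ] EuclideanSpace ℝ (Fin 3)) (s₁ s₂ : EuclideanSpace ℝ (Fin 3))
    (σ σ' : ℤ → ℤ) (hσ : IsHaggSeq σ) (hσ' : IsHaggSeq σ')
    (hsub₁ : (fun p => A₁ p + t₁) '' fccStacking 1 (Real.sqrt (2 / 3)) ⊆
      (fun p => L p + s₁) '' barlowStacking 1 (Real.sqrt (2 / 3)) σ)
    (hsub₂ : (fun p => A₂ p + t₂) '' fccStacking 1 (Real.sqrt (2 / 3)) ⊆
      (fun p => L p + s₂) '' barlowStacking 1 (Real.sqrt (2 / 3)) σ')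
    (htrans : A₁ '' fccStacking 1 (Real.sqrt (2 / 3)) = A₂ '' fccStacking 1 (Real.sqrt (2 / 3)))
    (hne : (fun p => A₁ p + t₁) '' fccStacking 1 (Real.sqrt (2 / 3)) ≠
      (fun p => A₂ p + t₂) '' fccStacking 1 (Real.sqrt (2 / 3))) :
    ∃ (L : EuclideanSpace ℝ (Fin 3) ≃ₗᵢ[ℝ] EuclideanSpace ℝ (Fin 3))
        (s₁ s₂ : EuclideanSpace ℝ (Fin 3)) (σ σ' : ℤ → ℤ), IsHaggSeq σ ∧ IsHaggSeq σ' ∧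
        (fun p => A₁ p + t₁) '' fccStacking 1 (Real.sqrt (2 / 3)) ⊆
          (fun p => L p + s₁) '' barlowStacking 1 (Real.sqrt (2 / 3)) σ ∧
        (fun p => A₂ p + t₂) '' fccStacking 1 (Real.sqrt (2 / 3)) ⊆
          (fun p => L p + s₂) '' barlowStacking 1 (Real.sqrt (2 / 3)) σ' ∧
    ∃ C R₀ : ℝ, 1 ≤ R₀ ∧ ∀ h : ℝ, 0 ≤ h → ∀ ρ : ℝ, R₀ ≤ ρ →
      ∀ X P₁ P₂ : Finset (EuclideanSpace ℝ (Fin 3)),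
      (∀ p ∈ X, ∀ q ∈ X, p ≠ q → 1 ≤ dist p q) → P₁ ⊆ X → P₂ ⊆ X \ P₁ →
      (∀ p ∈ X, -(2 * R₀) ≤ p 2 ∧ p 2 ≤ h + 2 * R₀ ∧ p 0 ^ 2 + p 1 ^ 2 ≤ ρ ^ 2) →
      (∀ p, p ∈ P₁ ↔ (p ∈ (fun q => A₁ q + t₁) '' fccStacking 1 (Real.sqrt (2 / 3)) ∧
        -(2 * R₀) ≤ p 2 ∧ p 2 ≤ -R₀ ∧ p 0 ^ 2 + p 1 ^ 2 ≤ ρ ^ 2)) →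
      (∀ p, p ∈ P₂ ↔ (p ∈ (fun q => A₂ q + t₂) '' fccStacking 1 (Real.sqrt (2 / 3)) ∧
        h + R₀ ≤ p 2 ∧ p 2 ≤ h + 2 * R₀ ∧ p 0 ^ 2 + p 1 ^ 2 ≤ ρ ^ 2)) →
      ((((P₁ ×ˢ (X \ P₁)).filter fun pq => dist pq.1 pq.2 = 1).card : ℕ) : ℝ) +
        ((((P₂ ×ˢ ((X \ P₁) \ P₂)).filter fun pq => dist pq.1 pq.2 = 1).card : ℕ) : ℝ) ≤
        contactDeficiency ((X \ P₁) \ P₂) +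
          (Real.sqrt 2 / 4 * ∑ᶠ w ∈ {w ∈ fccStacking 1 (Real.sqrt (2 / 3)) | ‖w‖ = 1},
              |⟪w, A₁.symm (EuclideanSpace.single (2 : Fin 3) (1 : ℝ))⟫_ℝ| +
            Real.sqrt 2 / 4 * ∑ᶠ w ∈ {w ∈ fccStacking 1 (Real.sqrt (2 / 3)) | ‖w‖ = 1},
              |⟪w, A₂.symm (EuclideanSpace.single (2 : Fin 3) (1 : ℝ))⟫_ℝ| -
            (1 / 2 : ℝ) * Real.sqrt (1 - ⟪L (EuclideanSpace.single (2 : Fin 3) (1 : ℝ)),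
              (EuclideanSpace.single (2 : Fin 3) (1 : ℝ))⟫_ℝ ^ 2)) * Real.pi * ρ ^ 2 +
          C * (1 + h) * ρ := by
  set e₃ : EuclideanSpace ℝ (Fin 3) := EuclideanSpace.single (2 : Fin 3) (1 : ℝ) with he₃
  set τ : EuclideanSpace ℝ (Fin 3) := A₁.symm (t₂ - t₁) with hτ
  have hτΛ : τ ∉ fccStacking 1 (Real.sqrt (2 / 3)) := offset_notMem_of_ne A₁ A₂ t₁ t₂ htrans hne
  have hsin : ∀ M : EuclideanSpace ℝ (Fin 3) ≃ₗᵢ[ℝ] EuclideanSpace ℝ (Fin 3),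
      0 ≤ Real.sqrt (1 - ⟪M e₃, e₃⟫_ℝ ^ 2) ∧ Real.sqrt (1 - ⟪M e₃, e₃⟫_ℝ ^ 2) ≤ 1 := by
    intro M
    refine ⟨Real.sqrt_nonneg _, ?_⟩
    rw [show (1 : ℝ) = Real.sqrt 1 from Real.sqrt_one.symm]
    exact Real.sqrt_le_sqrt (by rw [Real.sqrt_one]; nlinarith [sq_nonneg ⟪M e₃, e₃⟫_ℝ])
  have hπρ : ∀ ρ : ℝ, 0 ≤ Real.pi * ρ ^ 2 := fun ρ => by positivity
  have hΛ₂ : A₂ '' fccStacking 1 (Real.sqrt (2 / 3)) = A₁ '' fccStacking 1 (Real.sqrt (2 / 3)) := htrans.symm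
  rcases skew_trichotomy_fin τ with hall | ⟨k, hk⟩ | ⟨c, hcube⟩
  · -- (A) generic offset: orientation-free `1/44`, frame `L`
    obtain ⟨C, R₀, hR₀, hmain⟩ := translate_twoSlabAdhesion_generic_sharp hg hδ0 hδ hK hs₀ hcert hcertA A₁ t₁ A₂ t₂
      htrans (fun k => generic_of_allInt τ hall hτΛ k)
    refine ⟨L, s₁, s₂, σ, σ', hσ, hσ', hsub₁, hsub₂, C, R₀, hR₀, ?_⟩
    intro h hh ρ hρ X P₁ P₂ hX hP₁X hP₂X₁ hcyl hP₁ hP₂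
    have key := hmain h hh ρ hρ X P₁ P₂ hX hP₁X hP₂X₁ hcyl hP₁ hP₂
    have hc' : 1 / 2 * Real.sqrt (1 - ⟪L e₃, e₃⟫_ℝ ^ 2) ≤ 1 / 2 := by
      obtain ⟨-, h1⟩ := hsin L; linarith only [h1]
    have := mul_le_mul_of_nonneg_right hc' (hπρ ρ)
    linarith only [key, this]
  · -- (B) a doubly skew axis: skew root AND a re-picked axis, frame `L'`
    obtain ⟨w, hw, s, hs, hws, hskew, L', hL', hrise⟩ := exists_skewRoot_of_axis_sine τ k hk A₁
    have hs2 : 0 < Real.sqrt 2 := by positivity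
    have h0 : 0 ≤ Real.sqrt (1 - ⟪L' e₃, e₃⟫_ℝ ^ 2) / Real.sqrt 2 := by
      obtain ⟨h0', -⟩ := hsin L'; positivity
    obtain ⟨C, R₀, hR₀, hmain⟩ := translate_twoSlabAdhesion_sharp hg hδ0 hδ hK hs₀ hcert hcertA A₁ t₁ A₂ t₂ htrans hw
      (le_trans h0 hrise) hs hws hskew
    refine ⟨L', t₁, t₂, constHagg, constHagg, isHaggSeq_const, isHaggSeq_const,
      movedFcc_subset_frame_of_image_eq A₁ L' t₁ hL'.symm,
      movedFcc_subset_frame_of_image_eq A₂ L' t₂ (hΛ₂.trans hL'.symm), C, R₀, hR₀, ?_⟩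
    intro h hh ρ hρ X P₁ P₂ hX hP₁X hP₂X₁ hcyl hP₁ hP₂
    have key := hmain h hh ρ hρ X P₁ P₂ hX hP₁X hP₂X₁ hcyl hP₁ hP₂
    have hc' : 1 / 2 * Real.sqrt (1 - ⟪L' e₃, e₃⟫_ℝ ^ 2) ≤ Real.sqrt 2 * (A₁ w) 2 / 2 := by
      have h1 : Real.sqrt (1 - ⟪L' e₃, e₃⟫_ℝ ^ 2) ≤ Real.sqrt 2 * (A₁ w) 2 := by
        have := mul_le_mul_of_nonneg_left hrise hs2.le
        rw [mul_div_cancel₀ _ hs2.ne'] at this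
        exact this
      linarith only [h1]
    have := mul_le_mul_of_nonneg_right hc' (hπρ ρ)
    linarith only [key, this]
  · -- (C) a skew `{111}` plane: the defender's frame `L' = A₁ ∘ G`
    obtain ⟨L', hL', hskew⟩ := exists_skewFrame_of_cube A₁ τ c hcube
    have hsub₁' := movedFcc_subset_frame_of_image_eq A₁ L' t₁ hL'.symm
    have hsub₂' := movedFcc_subset_frame_of_image_eq A₂ L' t₂ (hΛ₂.trans hL'.symm)
    obtain ⟨C, R₀, hR₀, hmain⟩ := coaxialTwoSlabAdhesion_trans_skew_sharp hg hδ0 hδ hK hs₀ hcert hcertA A₁ t₁ A₂ t₂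
      L' t₁ constHagg isHaggSeq_const hsub₁' htrans hskew
    refine ⟨L', t₁, t₂, constHagg, constHagg, isHaggSeq_const, isHaggSeq_const, hsub₁', hsub₂', C, R₀, hR₀, ?_⟩
    intro h hh ρ hρ X P₁ P₂ hX hP₁X hP₂X₁ hcyl hP₁ hP₂
    have key := hmain h hh ρ hρ X P₁ P₂ hX hP₁X hP₂X₁ hcyl hP₁ hP₂
    have hc' : 1 / 2 * Real.sqrt (1 - ⟪L' e₃, e₃⟫_ℝ ^ 2) ≤
        Real.sqrt 6 / 4 * Real.sqrt (1 - ⟪L' e₃, e₃⟫_ℝ ^ 2) := by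
      obtain ⟨h0', -⟩ := hsin L'
      have h6 : (2 : ℝ) ≤ Real.sqrt 6 := by
        rw [show (2 : ℝ) = Real.sqrt (2 ^ 2) by rw [Real.sqrt_sq (by norm_num)]]
        exact Real.sqrt_le_sqrt (by norm_num)
      nlinarith [h0', h6]
    have := mul_le_mul_of_nonneg_right hc' (hπρ ρ)
    linarith only [key, this]

/-- **THE REGISTERED STUB `CoaxialTwoSlabAdhesion` OF LINE `WallLedgerF`, MODULO THE NAMED CENSUS FACTS.**  Every
co-axial pair of distinct moved fcc lattices, arbitrary fillings, the stub's own constant `½`.  CONDITIONAL on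
`KissingGap δ` (`δ > 0`, `δ² > 16/3`), the E1 rows (`hcert`, `hcertA`) and `KFoldTopDeficit`.  See the module
docstring. -/
theorem coaxialTwoSlabAdhesion_of_census :
    Summit.Ventures.Crystal3D.Cruxes.CoaxialWallLaw.WallLedgerF.CoaxialTwoSlabAdhesion := by
  classical
  intro A₁ t₁ A₂ t₂ hcoax hne
  obtain ⟨L, s₁, s₂, σ, σ', hσ, hσ', hsub₁, hsub₂⟩ := hcoax
  by_cases htrans : A₁ '' fccStacking 1 (Real.sqrt (2 / 3)) = A₂ '' fccStacking 1 (Real.sqrt (2 / 3))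
  · exact coaxialTwoSlabAdhesion_translate_of_census hg hδ0 hδ hK hs₀ hcert hcertA A₁ t₁ A₂ t₂ L s₁ s₂ σ σ' hσ hσ'
      hsub₁ hsub₂ htrans hne
  · -- twin pair: 19481-p1's sharp twin law at the stub's constant, frame `L`
    obtain ⟨C, R₀, hR₀, hmain⟩ := coaxialTwoSlabAdhesion_general_twin_of_census hg hδ0 hδ hK hs₀ hcert hcertA A₁ t₁
      A₂ t₂ L s₁ s₂ σ σ' hσ hσ' hsub₁ hsub₂ htrans
    exact ⟨L, s₁, s₂, σ, σ', hσ, hσ', hsub₁, hsub₂, C, R₀, hR₀, hmain⟩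

end Exact

end Summit.Ventures.Crystal3D.Theorems

end
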